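import Summits.BirchSwinnertonDyer.BirchSwinnertonDyer.Theses.PrintX8VS
import Summits.BirchSwinnertonDyer.BirchSwinnertonDyer.Theorems.SignedLowerHalvesSprungLowerDivisibilityAtThreeIotaDoorStubs
import Summits.BirchSwinnertonDyer.BirchSwinnertonDyer.Theorems.SignedLowerHalvesSprungLowerDivisibilityAtThreeCokerBoundByMassOfThm714
import HarnessLib

/-!
# Route `PrintX8VS`, crux 23401 `KatoSporadicPosLevelGivenHeldX8C` (keying-honest child of K1 `SprungLowerDivisibilityAtThree`,
# item 19875), line `chromatic-common-zeros`: THE CRUX BY NAME from THREE named printed facts and the research residue R♮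

Cell `bsd-ssimc` (host), width seat `cruxlead-stmt-BirchSwinnertonDyer-19875-w2` (gen 10) under the 19875 LEAD;
`--supports stmt-BirchSwinnertonDyer-23401 --as helper`; THEOREMS ONLY; closes NO item (R♮ is displayed). The registered ι-door
skeleton on 23401 (`Cruxes/SprungLowerDivisibilityAtThree/Lines/child23401_iota_door.lean`, LEAD g6) composes the crux from two
stubs: F-α♮ `stub_cokerBoundIotaOffT` (input-free) and R♮ `stub_katoFineLowerResidueIotaOffTC (h714) (h716c) (h3)`, via
`ChromaticCommonZeros.stubs_offT_of_iotaDoor`. F-α♮ is now a theorem modulo THREE outside named facts and the crux's own guard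
`h714` (`ChromaticCommonZeros.cokerBoundIotaOffT_of_poitouTate_of_thm714`, this seat's `…CokerBoundByMassOfThm714.lean`), so:

* **`KatoSporadicPosLevelGivenHeldX8C_of_threeFacts_of_residue (hPT) (h124) (hMatar) (hR)`** : the crux decl
  `Theses.PrintX8VS.KatoSporadicPosLevelGivenHeldX8C` BY NAME, from `Sprung2012.thm714seq_sharpFlat_poitouTate_functionalModel`
  (Poitou–Tate in the functional model; Sprung (3) + Kobayashi Prop. 7.1 / Thm. 7.3), `Kato2004.thm12_4` (Kato Thm. 12.4),
  `matar2020_thm11_selmerDualTorsion_pseudoIso_fineSelmerDual` (Matar 2020 Thm. 1.1 / Wingberg) and `hR` = the R♮ stub's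
  statement VERBATIM (behind its three guard binders) — one named fact FEWER than the LEAD's
  `…OfPrintedFacts.KatoSporadicPosLevelGivenHeldX8C_of_printedFacts_of_residue` (no `Kato2004_fineSelmerDual_isTorsion`:
  inside the guard, `X₀` is torsion by Thm. 7.14 via `X♯ ↠ X₀`).

R♮ (Kato's fine inequality at the loose ι-orbits off `(T)`) is the research residue and is NOT proved; the three facts are typed
print, NOT proved; BSD, K1, K_spor, 23401 are NOT proved by any of this.
-/

-- the single-conjunct summit namespace `Summit.BirchSwinnertonDyer.BirchSwinnertonDyer` repeats by design (D-0017)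
set_option linter.dupNamespace false
set_option autoImplicit false

noncomputable section

open scoped Classical NumberField MatrixGroups ModularForm

open NumberField IsDedekindDomain CongruenceSubgroup WeierstrassCurve Field
  Literature.NumberTheory.EllipticCurves Literature.NumberTheory.EllipticCurves.ModularForms
  Literature.NumberTheory.EllipticCurves.ZpExtension Literature.NumberTheory.EllipticCurves.Sprung2017
  Literature.NumberTheory.EllipticCurves.Sprung2012 Literature.NumberTheory.EllipticCurves.Rank1Residual
  Literature.NumberTheory.EllipticCurves.IwasawaAlgebra Literature.NumberTheory.EllipticCurves.Kato2004
  Literature.NumberTheory.EllipticCurves.Module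
  Summit.BirchSwinnertonDyer.BirchSwinnertonDyer.Theorems

namespace Summit.BirchSwinnertonDyer.BirchSwinnertonDyer.Theorems.KatoSporadicThreeFacts

/-- **Crux 23401 `KatoSporadicPosLevelGivenHeldX8C` BY NAME from three named printed facts and the residue R♮.** Hypotheses:
`hPT` (Poitou–Tate functional model, Sprung 2012 (3) / Kobayashi 2003 7.1–7.3), `h124` (Kato 2004 Thm. 12.4), `hMatar`
(Matar 2020 Thm. 1.1), and `hR` = the registered stub `stub_katoFineLowerResidueIotaOffTC` VERBATIM (Kato's fine inequality
`ℓ_𝔭(𝐇¹/Z) ≤ ℓ_𝔭 X₀` at the height-one primes off `(p), (T)` where the mirror local index is below the zeta index, behind the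
guard binders `h714 h716c h3`). Proof: introduce the guard, feed F-α♮ := `cokerBoundIotaOffT_of_poitouTate_of_thm714 hPT h124
hMatar h714` and R♮ := `hR h714 h716c h3` to `ChromaticCommonZeros.stubs_offT_of_iotaDoor`, project the two conjuncts. -/
theorem KatoSporadicPosLevelGivenHeldX8C_of_threeFacts_of_residue
    (hPT : thm714seq_sharpFlat_poitouTate_functionalModel) (h124 : Kato2004.thm12_4)
    (hMatar : matar2020_thm11_selmerDualTorsion_pseudoIso_fineSelmerDual)
    (hR : thm714_sharpFlatSelmerDual_finite_torsion → thm716_sharpFlatCharIdeal_divisibility_contra →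
      realPeriodRat_eq_unit_mul_plusPeriod_three →
  ∀ (W : WeierstrassCurve ℚ) [W.IsElliptic] [W.IsGloballyMinimal] (p : ℕ) [Fact p.Prime]
        [ContinuousSMul ℤ_[p] (W.tateModule p)] [Module.Free ℤ_[p] (W.tateModule p)]
        [Module.Finite ℤ_[p] (W.tateModule p)],
        ClassX8 W p → ∀ (κ : ZpExtension ℚ p) (γ : Field.absoluteGaloisGroup ℚ),
        κ.IsCyclotomic → κ.IsTopGenerator γ → IsCyclotomicVariable p γ →
      ∀ (v : HeightOneSpectrum (𝓞 ℚ)), (p : 𝓞 ℚ) ∈ v.asIdeal →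
      ∀ (g : Field.absoluteGaloisGroup (v.adicCompletion ℚ)),
        κ.IsTopGenerator (resGalOfEmb (closureEmb (K := ℚ) (v.adicCompletion ℚ)) g) →
      ∀ (cneg : localPoints W (v.adicCompletion ℚ)) (c : ℕ → localPoints W (v.adicCompletion ℚ)),
        IsHondaSystem κ (closureEmb (K := ℚ) (v.adicCompletion ℚ)) W (W.frobeniusTrace p) g cneg c →
      ∀ (N : ℕ) (_ : NeZero N) (f : CuspForm (Gamma0 N) 2) (ϖ : ℚ) (Lsharp Lflat : IwasawaAlgebra p),
        IsNewformOf W f → (ϖ : ℝ) * W.realPeriodRat = plusPeriod f →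
        IsSprungPair f p (W.frobeniusTrace p) Lsharp Lflat →
      ∀ (I : Kato2004.IwasawaH1Data W p κ γ)
        (Cs : SharpFlatColemanKatoData W p f ϖ κ γ (closureEmb (K := ℚ) (v.adicCompletion ℚ))
          (W.frobeniusTrace p) g c Chroma.sharp I)
        (Cf : SharpFlatColemanKatoData W p f ϖ κ γ (closureEmb (K := ℚ) (v.adicCompletion ℚ))
          (W.frobeniusTrace p) g c Chroma.flat I),
        Cs.Z = Cf.Z →
      ∀ (Y : W.FineSelmerDualData κ γ) (𝔭 : PrimeSpectrum (IwasawaAlgebra p)), 𝔭.asIdeal.height = 1 →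
        (p : IwasawaAlgebra p) ∉ 𝔭.asIdeal → (PowerSeries.X : IwasawaAlgebra p) ∉ 𝔭.asIdeal →
        (∀ (col' : Chroma) (G' : IwasawaAlgebra p),
          iwasawaToPowerSeries p G' =
            PowerSeries.C (ϖ : ℚ_[p]) * iwasawaToPowerSeries p (chromaticL col' Lsharp Lflat) →
          G' ∈ 𝔭.asIdeal) →
        min (Module.lengthAt (IwasawaAlgebra p) (IwasawaAlgebra p ⧸ LinearMap.range Cs.colMap)
              (PrimeSpectrum.comap (invol p).toRingHom 𝔭))
            (Module.lengthAt (IwasawaAlgebra p) (IwasawaAlgebra p ⧸ LinearMap.range Cf.colMap)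
              (PrimeSpectrum.comap (invol p).toRingHom 𝔭)) <
            Module.lengthAt (IwasawaAlgebra p) (I.H ⧸ Cs.Z) 𝔭 →
        Module.lengthAt (IwasawaAlgebra p) (I.H ⧸ Cs.Z) 𝔭 ≤ Module.lengthAt (IwasawaAlgebra p) Y.X 𝔭) :
    Summit.BirchSwinnertonDyer.BirchSwinnertonDyer.Theses.PrintX8VS.KatoSporadicPosLevelGivenHeldX8C := by
  intro h714 h716c h3
  have hF := ChromaticCommonZeros.cokerBoundIotaOffT_of_poitouTate_of_thm714 hPT h124 hMatar h714
  refine ⟨?_, ?_⟩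
  · intro W _ _ p _ _ _ _ hX
    exact (ChromaticCommonZeros.stubs_offT_of_iotaDoor hF (hR h714 h716c h3)).1 W p hX
  · intro W _ _ p _ _ _ _ hX
    exact (ChromaticCommonZeros.stubs_offT_of_iotaDoor hF (hR h714 h716c h3)).2 W p hX

end Summit.BirchSwinnertonDyer.BirchSwinnertonDyer.Theorems.KatoSporadicThreeFacts

end
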